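import Mathlib
import Summits.NavierStokesRegularity.NavierStokesRegularity.Theorems.EulerZoomLiouvillePowerGaugeEulerLiouvilleCondenserGradientRiccati
import Summits.NavierStokesRegularity.NavierStokesRegularity.Theorems.IsobarTomographyIsobaricLinesLiouvilleStubErtelIdentity

/-!
# THEOREM U — UNIDIRECTIONAL RIGIDITY (nsreg-p2 g34 ROUND-44 §2, plate t46-U)

Width piece for crux `EulerZoomLiouville.PowerGaugeEulerLiouville` (stmt-NavierStokesRegularity-19832), by name under LEAD 19832
(ns-typeII-p2 g13); seat ns-ezl-w2 g4, `--supports stmt-NavierStokesRegularity-19832 --as helper`.  Text = nsreg-p2's Sketch44 Prop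
`NsregP2.R44.UnidirectionalRigidity` binder-for-binder (`E3` spelled out).

For a self-similar Euler profile `(U, P)` (CIV (3.3), centre `0`, `W y = γy + U y`) that is UNIDIRECTIONAL on an open set `O`,
`U y = −s(y)·e` (`‖e‖ = 1`, `s ∈ C¹`), at every `y ∈ O`:

* (i) `∂_e s = 0` — incompressibility (`tr DU = −Ds(e)`);
* (ii) `⟪∇P, v⟫ = 0` for `v ⊥ e` and (iii) `⟪∇P, e⟫ = (1−γ)s + γ·Ds(y)[y]` — the profile equation reads `∇P = ((1−γ)s + γ Ds(y)[y])·e`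
  (`DU(W) = −Ds(W)·e = −γDs(y)[y]·e` by (i));
* (iv) `D⟪∇P, e⟫(y) = 0` — `∂_eP` is locally constant: `D(∇P)(y)e = 0` (from t45-R's `D(∇P) = −((1−γ)DU + DU∘(γ·id + DU) + D²U(W,·))`,
  `DU e = 0` on `O`, and `D²U(y)(e)(W) = D²U(y)(W)(e) = ∂_W[DU·e] = 0`), then the symmetry of the pressure Hessian
  (`P ∈ C²`, `IsSelfSimilarEulerProfile.contDiff_two_pressure`).

So a `C²` unidirectional region is governed by `s = π₀/(1−γ) + h(θ)|y_⊥|^{−(1+ρ)}` along transverse rays («no pressure work, no needle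
core»; the integration is left to the reader of the memo).  Main decls: `fderiv_velocity_eq_of_unidirectional`, `fderiv_apply_dir_eq_zero`,
`gradient_pressure_eq_of_unidirectional`, `fderiv_gradient_pressure_apply_dir_eq_zero`, **`unidirectional_rigidity`**, `unidirectionalRigidity`.
HONEST FRAMING: calculus for HYPOTHETICAL self-similar Euler profiles (MODEL lattice of the crux class); nothing here proves the crux E
(19832 OPEN), any door Target, or Navier–Stokes regularity. [cite: ConstantinIgnatovaVicol2026Putative, §3.1.1 eq. (3.3)]
-/

noncomputable section

open Set Filter Topology Metric Function InnerProductSpace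
open scoped RealInnerProductSpace

set_option linter.dupNamespace false

namespace Summit.NavierStokesRegularity.NavierStokesRegularity.Theorems.PowerGaugeEulerLiouville.Unidirectional

open Literature.Analysis Literature.Analysis.FluidPDE
open Summit.NavierStokesRegularity.NavierStokesRegularity.Theorems.PowerGaugeEulerLiouville

variable {γ : ℝ} {U : EuclideanSpace ℝ (Fin 3) → EuclideanSpace ℝ (Fin 3)} {P : EuclideanSpace ℝ (Fin 3) → ℝ}
  {e : EuclideanSpace ℝ (Fin 3)} {s : EuclideanSpace ℝ (Fin 3) → ℝ} {O : Set (EuclideanSpace ℝ (Fin 3))}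

/-- On the unidirectional region, `DU(x) h = −(Ds(x) h)·e`. [folklore] -/
theorem fderiv_velocity_eq_of_unidirectional (hs : ContDiff ℝ 1 s) (hO : IsOpen O) (hUO : ∀ y ∈ O, U y = -(s y) • e)
    {x : EuclideanSpace ℝ (Fin 3)} (hx : x ∈ O) :
    fderiv ℝ U x = -((fderiv ℝ s x).smulRight e) := by
  have hev : U =ᶠ[𝓝 x] fun z => -(s z) • e :=
    Filter.eventually_of_mem (hO.mem_nhds hx) fun z hz => hUO z hz
  rw [hev.fderiv_eq]
  have h1 : HasFDerivAt (fun z => -(s z) • e) (-((fderiv ℝ s x).smulRight e)) x := by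
    have h := ((hs.differentiable one_ne_zero x).hasFDerivAt.smul_const e).neg
    refine h.congr_of_eventuallyEq (Filter.Eventually.of_forall fun z => ?_)
    simp [neg_smul]
  exact h1.fderiv

/-- **(i) `∂_e s = 0` on the region** (incompressibility: `0 = tr DU(x) = −Ds(x) e`). [cite: ConstantinIgnatovaVicol2026Putative, §3.1.1 eq. (3.3)] -/
theorem fderiv_dir_eq_zero (hprof : IsSelfSimilarEulerProfile γ 0 U P) (hs : ContDiff ℝ 1 s) (hO : IsOpen O)
    (hUO : ∀ y ∈ O, U y = -(s y) • e) {x : EuclideanSpace ℝ (Fin 3)} (hx : x ∈ O) :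
    fderiv ℝ s x e = 0 := by
  have hdiv : LinearMap.trace ℝ _ (fderiv ℝ U x : EuclideanSpace ℝ (Fin 3) →ₗ[ℝ] EuclideanSpace ℝ (Fin 3)) = 0 :=
    hprof.divFree x
  rw [fderiv_velocity_eq_of_unidirectional hs hO hUO hx] at hdiv
  set b := stdOrthonormalBasis ℝ (EuclideanSpace ℝ (Fin 3)) with hb
  rw [LinearMap.trace_eq_sum_inner _ b] at hdiv
  simp only [ContinuousLinearMap.coe_coe, _root_.neg_apply, ContinuousLinearMap.smulRight_apply,
    inner_neg_right, inner_smul_right] at hdiv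
  -- `Σ ⟪b i, e⟫ Ds(b i) = Ds (Σ ⟪b i, e⟫ b i) = Ds e`
  have hsum : ∑ i, fderiv ℝ s x (b i) * ⟪b i, e⟫ = fderiv ℝ s x e := by
    have h1 : ∑ i, ⟪b i, e⟫ • b i = e := b.sum_repr' e
    calc ∑ i, fderiv ℝ s x (b i) * ⟪b i, e⟫ = ∑ i, fderiv ℝ s x (⟪b i, e⟫ • b i) := by
          refine Finset.sum_congr rfl fun i _ => ?_
          rw [map_smul, smul_eq_mul, mul_comm]
      _ = fderiv ℝ s x (∑ i, ⟪b i, e⟫ • b i) := by rw [map_sum]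
      _ = fderiv ℝ s x e := by rw [h1]
  rw [← hsum]
  have : ∑ i, -(fderiv ℝ s x (b i) * ⟪b i, e⟫) = 0 := hdiv
  rw [Finset.sum_neg_distrib, neg_eq_zero] at this
  exact this

/-- **`DU(x) e = 0` on the region** (from (i)). [cite: ConstantinIgnatovaVicol2026Putative, §3.1.1 eq. (3.3)] -/
theorem fderiv_apply_dir_eq_zero (hprof : IsSelfSimilarEulerProfile γ 0 U P) (hs : ContDiff ℝ 1 s) (hO : IsOpen O)
    (hUO : ∀ y ∈ O, U y = -(s y) • e) {x : EuclideanSpace ℝ (Fin 3)} (hx : x ∈ O) :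
    fderiv ℝ U x e = 0 := by
  rw [fderiv_velocity_eq_of_unidirectional hs hO hUO hx, _root_.neg_apply, ContinuousLinearMap.smulRight_apply,
    fderiv_dir_eq_zero hprof hs hO hUO hx, zero_smul, neg_zero]

/-- **(ii)+(iii) THE PROFILE EQUATION ON THE REGION**: `∇P(y) = ((1−γ)s(y) + γ·Ds(y)[y])·e`. [cite: ConstantinIgnatovaVicol2026Putative, §3.1.1 eq. (3.3)] -/
theorem gradient_pressure_eq_of_unidirectional (hprof : IsSelfSimilarEulerProfile γ 0 U P) (hs : ContDiff ℝ 1 s)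
    (hO : IsOpen O) (hUO : ∀ y ∈ O, U y = -(s y) • e) {y : EuclideanSpace ℝ (Fin 3)} (hy : y ∈ O) :
    gradient P y = ((1 - γ) * s y + γ * fderiv ℝ s y y) • e := by
  have h := congrFun (Condenser.gradient_pressure_eq hprof) y
  simp only [Pi.neg_apply, Pi.add_apply, Pi.smul_apply] at h
  rw [h, fderiv_velocity_eq_of_unidirectional hs hO hUO hy, _root_.neg_apply, ContinuousLinearMap.smulRight_apply,
    selfSimilarTransport_apply, sub_zero, hUO y hy, map_add, map_smul, map_smul, fderiv_dir_eq_zero hprof hs hO hUO hy]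
  simp only [smul_eq_mul, mul_zero, add_zero]
  module

/-- **`D(∇P)(y) e = 0` on the region** (t45-R's differentiated profile equation; `DU e = 0` on `O`; `D²U(y)(e)(W y) = ∂_W[DU·e](y) = 0`).
[cite: ConstantinIgnatovaVicol2026Putative, §3.1.1 eq. (3.3)] -/
theorem fderiv_gradient_pressure_apply_dir_eq_zero (hprof : IsSelfSimilarEulerProfile γ 0 U P)
    (hs : ContDiff ℝ 1 s) (hO : IsOpen O) (hUO : ∀ y ∈ O, U y = -(s y) • e) {y : EuclideanSpace ℝ (Fin 3)} (hy : y ∈ O) :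
    fderiv ℝ (gradient P) y e = 0 := by
  have hDUe : ∀ x ∈ O, fderiv ℝ U x e = 0 := fun x hx => fderiv_apply_dir_eq_zero hprof hs hO hUO hx
  -- `x ↦ DU(x) e` vanishes near `y`, so `(D²U(y) w) e = 0`
  have hΦ : HasFDerivAt (fun x => fderiv ℝ U x e) ((fderiv ℝ (fderiv ℝ U) y).flip e) y := by
    have h := (Condenser.hasFDerivAt_fderiv_velocity hprof y).clm_apply (hasFDerivAt_const e y)
    refine h.congr_fderiv ?_
    ext w
    simp [ContinuousLinearMap.flip_apply]
  have h0 : HasFDerivAt (fun x => fderiv ℝ U x e) (0 : EuclideanSpace ℝ (Fin 3) →L[ℝ] EuclideanSpace ℝ (Fin 3)) y := by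
    refine (hasFDerivAt_const (0 : EuclideanSpace ℝ (Fin 3)) y).congr_of_eventuallyEq ?_
    filter_upwards [hO.mem_nhds hy] with x hx
    exact hDUe x hx
  have hflip : (fderiv ℝ (fderiv ℝ U) y).flip e = 0 := hΦ.unique h0
  have hD2 : (fderiv ℝ (fderiv ℝ U) y).flip (selfSimilarTransport γ 0 U y) e = 0 := by
    rw [ContinuousLinearMap.flip_apply, Condenser.fderiv_fderiv_apply_eq_flip hprof y e, hflip,
      _root_.zero_apply]
  rw [Condenser.fderiv_gradient_pressure_eq hprof y]
  simp only [_root_.neg_apply, _root_.add_apply, FunLike.coe_smul, Pi.smul_apply,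
    ContinuousLinearMap.comp_apply, ContinuousLinearMap.id_apply, hDUe y hy, hD2, map_smul, smul_zero, add_zero,
    neg_zero]

/-- **THEOREM U — UNIDIRECTIONAL RIGIDITY, pointwise** ((i)–(iv) of the memo). [cite: ConstantinIgnatovaVicol2026Putative, §3.1.1 eq. (3.3)] -/
theorem unidirectional_rigidity (hprof : IsSelfSimilarEulerProfile γ 0 U P) (he : ‖e‖ = 1) (hs : ContDiff ℝ 1 s) (hO : IsOpen O)
    (hUO : ∀ y ∈ O, U y = -(s y) • e) {y : EuclideanSpace ℝ (Fin 3)} (hy : y ∈ O) :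
    fderiv ℝ s y e = 0 ∧
      (∀ v : EuclideanSpace ℝ (Fin 3), ⟪v, e⟫ = 0 → ⟪gradient P y, v⟫ = 0) ∧
      ⟪gradient P y, e⟫ = (1 - γ) * s y + γ * fderiv ℝ s y y ∧
      fderiv ℝ (fun x : EuclideanSpace ℝ (Fin 3) => ⟪gradient P x, e⟫) y = 0 := by
  have hgrad := gradient_pressure_eq_of_unidirectional hprof hs hO hUO hy
  refine ⟨fderiv_dir_eq_zero hprof hs hO hUO hy, fun v hv => ?_, ?_, ?_⟩
  · rw [hgrad, real_inner_smul_left, real_inner_comm, hv, mul_zero]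
  · rw [hgrad, real_inner_smul_left, real_inner_self_eq_norm_sq, he, one_pow, mul_one]
  · -- (iv): `D⟪∇P, e⟫(y) h = ⟪D(∇P)(y) h, e⟫ = ⟪D(∇P)(y) e, h⟫ = 0`
    have hP2 : ContDiff ℝ 2 P := hprof.contDiff_two_pressure
    have hfun : (fun x : EuclideanSpace ℝ (Fin 3) => ⟪gradient P x, e⟫) = fun x => innerSL ℝ e (gradient P x) := by
      funext x; rw [innerSL_apply_apply, real_inner_comm]
    have hF : HasFDerivAt (fun x : EuclideanSpace ℝ (Fin 3) => ⟪gradient P x, e⟫)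
        ((innerSL ℝ e).comp (fderiv ℝ (gradient P) y)) y := by
      rw [hfun]
      exact (innerSL ℝ e).hasFDerivAt.comp y (Condenser.hasFDerivAt_gradient_pressure hprof y).differentiableAt.hasFDerivAt
    rw [hF.fderiv]
    ext h
    rw [ContinuousLinearMap.comp_apply, innerSL_apply_apply, _root_.zero_apply]
    have hsymm := IsobaricLinesLiouville.FluxSurfacePersistence.inner_fderiv_gradient_comm hP2 y e h
    -- `hsymm : ⟪e, D(∇P) h⟫ = ⟪h, D(∇P) e⟫`
    have e1 : (fun x => gradient P x) = gradient P := rfl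
    rw [e1] at hsymm
    rw [hsymm, fderiv_gradient_pressure_apply_dir_eq_zero hprof hs hO hUO hy, inner_zero_right]

/-- **`NsregP2.R44.UnidirectionalRigidity`** (Sketch44 of nsreg-p2 g34, plate t46-U; `E3` spelled out). [cite: ConstantinIgnatovaVicol2026Putative, §3.1.1 eq. (3.3)] -/
theorem unidirectionalRigidity :
    ∀ (γ : ℝ) (U : EuclideanSpace ℝ (Fin 3) → EuclideanSpace ℝ (Fin 3)) (P : EuclideanSpace ℝ (Fin 3) → ℝ),
      IsSelfSimilarEulerProfile γ 0 U P →
      ∀ (e : EuclideanSpace ℝ (Fin 3)) (s : EuclideanSpace ℝ (Fin 3) → ℝ) (O : Set (EuclideanSpace ℝ (Fin 3))),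
        ‖e‖ = 1 → ContDiff ℝ 1 s → IsOpen O → (∀ y ∈ O, U y = -(s y) • e) →
        ∀ y ∈ O,
          fderiv ℝ s y e = 0 ∧
            (∀ v : EuclideanSpace ℝ (Fin 3), ⟪v, e⟫ = 0 → ⟪gradient P y, v⟫ = 0) ∧
            ⟪gradient P y, e⟫ = (1 - γ) * s y + γ * fderiv ℝ s y y ∧
            fderiv ℝ (fun x : EuclideanSpace ℝ (Fin 3) => ⟪gradient P x, e⟫) y = 0 :=
  fun _ _ _ hprof _ _ _ he hs hO hUO _ hy => unidirectional_rigidity hprof he hs hO hUO hy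

end Summit.NavierStokesRegularity.NavierStokesRegularity.Theorems.PowerGaugeEulerLiouville.Unidirectional

end
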